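import Summits.BirchSwinnertonDyer.BirchSwinnertonDyer.Theorems.PrintX8VerticalStevensSpan
import Summits.BirchSwinnertonDyer.BirchSwinnertonDyer.Theorems.PrintX8VerticalStevens
import HarnessLib

/-!
# Route `PrintX8`, crux 20622 `MuBoundSmallImageX8` — LINE «vertical Stevens at 3»: VS-0 ⟹ 20622 BY NAME

Cell `bsd-print-x8`, seat p1 (gen 4), `--supports stmt-BirchSwinnertonDyer-20622`.  Three one-line compositions of
this seat's VS-0 ⟹ VS-1 (`PrintX8VerticalStevensSpan`, bridge `PrintX8VerticalStevensBridge`) with seat p3's VS-1 ⟹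
20622 (`PrintX8VerticalStevens.muBoundSmallImageX8_of_cycWindingNonConstantSmallImageX8`, p561175, which holds the
`p = 3` collapse VS-G and the held inputs of item 20771: `hCK` = item 20772, `h3` = the period fact at `3`).
The group-theoretic hypothesis is displayed in three spellings: `EisSpanModGen M 3` (mod-`3` form certified by
kit j286420/j286464 and referee R-68b for `M ≤ 1454`/`500`), `EisSpanGen M 3` (planner's VS-0 `EisSpanAtThree`), and
`ConjSpanGen M 3` (bsd-f3-mu MEMO-an §13 THEOREM B at `p = 3`; THEOREM (T) of `PrintX8VerticalStevensPrimeLevel`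
at prime `M` with `⟨−1,3⟩ = (ℤ/M)ˣ`).  No K1, no Galois-image input, no Conjecture A, no both-colour rider.
PARTITION: closes nothing (20622 stays open until VS-0 is a kernel theorem at every level); cells 0.
-/

-- the summit namespace repeats `BirchSwinnertonDyer` by design (summit = problem); linter moot
set_option linter.dupNamespace false
set_option autoImplicit false

noncomputable section

namespace Summit.BirchSwinnertonDyer.BirchSwinnertonDyer.Theorems.PrintX8VerticalStevens

open scoped Classical NumberField MatrixGroups ModularForm

open NumberField IsDedekindDomain WeierstrassCurve CongruenceSubgroup Field
  Literature.NumberTheory.EllipticCurves Literature.NumberTheory.EllipticCurves.ModularForms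
  Literature.NumberTheory.EllipticCurves.Rank1Residual
  Literature.NumberTheory.EllipticCurves.Sprung2017 Literature.NumberTheory.EllipticCurves.Sprung2012
  Literature.NumberTheory.EllipticCurves.GreenbergVatsal2000
  Literature.NumberTheory.EllipticCurves.ZpExtension Literature.NumberTheory.EllipticCurves.IwasawaAlgebra
  Summit.BirchSwinnertonDyer.BirchSwinnertonDyer.Theorems
  Summit.BirchSwinnertonDyer.BirchSwinnertonDyer.Theorems.PrintX8SharpFlatMuTransfer
  Summit.BirchSwinnertonDyer.BirchSwinnertonDyer.Theorems.PrintX8VerticalStevensCollapse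

section Crux

/-- **VS-0 (mod 3) ⟹ item 20622 `MuBoundSmallImageX8` BY NAME**, modulo the held facts `hCK` (item 20772 =
`Sprung2012.thm714seq_sharpFlatColemanKato_zeta`) and the period fact at `3` (= item 20771's inputs): VS-0 in
the mod-`3` generation form `EisSpanModGen M 3` at every level prime to `3` (ty2 p561961; referee R-68: the
form the kit certifies) ⟹ VS-1 (this seat's bridge) ⟹ 20622 (seat p3's by-name road p561175, collapse
VS-G inside).  No K1, no Galois-image input, no Conjecture A, no both-colour rider. -/
theorem muBoundSmallImageX8_of_eisSpanModAtThree (hCK : thm714seq_sharpFlatColemanKato_zeta)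
    (h3 : realPeriodRat_eq_unit_mul_plusPeriod_three)
    (hspan : ∀ (M : ℕ), 0 < M → ¬ 3 ∣ M → EisSpanModGen M 3) :
    Theses.PrintX8.MuBoundSmallImageX8 :=
  muBoundSmallImageX8_of_cycWindingNonConstantSmallImageX8 hCK h3
    (cycWindingNonConstantSmallImageX8_of_spanModAtThree hspan)

/-- **VS-0 ⟹ item 20622 BY NAME** with VS-0 in the planner's EIS-SPAN shape (`∀ M, 0 < M → ¬ 3 ∣ M →
EisSpanGen M 3` = `VS.EisSpanAtThree` of `plan/vs/SketchVS.lean` over ty2's carrier), modulo `hCK` and the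
period fact at `3`. -/
theorem muBoundSmallImageX8_of_eisSpanAtThree (hCK : thm714seq_sharpFlatColemanKato_zeta)
    (h3 : realPeriodRat_eq_unit_mul_plusPeriod_three)
    (hE : ∀ (M : ℕ), 0 < M → ¬ 3 ∣ M → EisSpanGen M 3) :
    Theses.PrintX8.MuBoundSmallImageX8 :=
  muBoundSmallImageX8_of_cycWindingNonConstantSmallImageX8 hCK h3
    (cycWindingNonConstantSmallImageX8_of_eisSpanAtThree hE)

/-- **THEOREM B at `p = 3` ⟹ item 20622 BY NAME**: VS-0 in the integral CONJ-SPAN form (`ConjSpanGen M 3`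
at every level prime to `3` = bsd-f3-mu MEMO-an §13 THEOREM B specialised; THEOREM (T) supplies it at the
prime levels with `⟨−1,3⟩ = (ℤ/M)ˣ`), modulo `hCK` and the period fact at `3`. -/
theorem muBoundSmallImageX8_of_conjSpanAtThree (hCK : thm714seq_sharpFlatColemanKato_zeta)
    (h3 : realPeriodRat_eq_unit_mul_plusPeriod_three)
    (hC : ∀ (M : ℕ), 0 < M → ¬ 3 ∣ M → ConjSpanGen M 3) :
    Theses.PrintX8.MuBoundSmallImageX8 :=
  muBoundSmallImageX8_of_eisSpanAtThree hCK h3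
    fun M hM h3M ↦ eisSpanGen_of_conjSpanGen (by norm_num) (hC M hM h3M)

end Crux

end Summit.BirchSwinnertonDyer.BirchSwinnertonDyer.Theorems.PrintX8VerticalStevens

end
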